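import Summits.SmoothPoincare4.SmoothPoincare4.Theorems.ConvexBisectionAcyclicBisectionExistsDualLinkTransport
import Summits.SmoothPoincare4.SmoothPoincare4.Theorems.ConvexBisectionAcyclicBisectionExistsPageTwistingTransverseLoop
import Summits.SmoothPoincare4.SmoothPoincare4.Theorems.ConvexBisectionAcyclicBisectionExistsKasBaseBoundary
import Literature.Geometry.Symplectic.LegendrianRealisationProofs
import Literature.Geometry.Symplectic.DefectZeroProofs
import HarnessLib

/-!
# Dual handles, T3c: ISO + TUBE — a link in `∂ Base g` isotopic, with its handle framings, to framed
# page curves is replaced by attaching maps along those page curves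
(sub-goal T3c-3 `node_dualLink_pageLink` of stub `stub_steinRealisation` (NF6), line
`modp-braid-orbits` r11, crux `ConvexBisection.AcyclicBisectionExists`, item stmt-SmoothPoincare4-10508;
wave 3, lead c5; registered sub-goal `helper_dualLink_pageLink_of`)

The `Base g`-side of node T3c-3: given attaching maps `q i` of 2-handles on `Base g` (the dual maps
of the suffix handles), an isotopy of links in `∂ Base g` from their attaching circles to framed page
curves `(K' i ⊂ page (c i), ν' i)` carrying the handle framings to framings homotopic to `ν' i`,
with all `K' i` of non-zero shadow and of one page twisting `ε = ±1`, there are attaching maps `h' i`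
ALONG the `K' i` (pairwise disjoint ranges, handle framings homotopic to `ν' i`, hence the same page
twisting) such that every multi-attachment along `q` is a multi-attachment along `h'`:

* §1 concatenation of isotopies of LINKS (`exists_linkIsotopy_trans`, componentwise
  `KnotIsotopyInBoundary.trans'`), re-indexing along an injection (`exists_linkIsotopy_reindex`),
  positive rescaling of framings (`framingHomotopic_smul_pos`); no `def`: the isotopies are produced
  existentially, with their components named;
* §2 the page twisting of a framed page curve only depends on the homotopy class of the framing
  (`pageTwisting_eq_of_framingHomotopic`: `pageTwisting_eq_of_bundle_family` with the non-vanishing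
  of the twisting loops of knot framings of page curves, `pageTwistingLoop_ne_zero_of_isKnotFraming`);
* §3 `helper_dualLink_pageLink_of`: TUBE (`exists_handleAttachingMap_of_isKnotFraming_holds`, inside
  pairwise disjoint open neighbourhoods of the `K' i`, `exists_pairwise_disjoint_open_of_isCompact`;
  `isOrientable_base`) and ISO (`isMultiAttachment_of_linkIsotopyInBoundary_holds`).

Everything is proved; no named facts, no `sorry`.

## References
* A. A. Kosinski, *Differential Manifolds* (1993), VI §6 and VIII, proof of (1.2). [Kosinski1993]
* R. İ. Baykur, *Kähler decomposition of 4-manifolds*, AGT 6 (2006), proof of Thm. 5.1. [Baykur2006]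
* J. B. Etnyre, T. Fuller, *Realizing 4-manifolds as achiral Lefschetz fibrations*, IMRN 2006, §2.
  [EtnyreFuller2006]
-/

noncomputable section

-- the prescribed namespace `Summit.<P>.<Sub>.…` duplicates `SmoothPoincare4` (P = Sub)
set_option linter.dupNamespace false

open scoped Manifold ContDiff Topology

namespace Summit.SmoothPoincare4.SmoothPoincare4.Theorems.AcyclicBisectionExists.ModpBraidOrbits

open Set Function Filter Metric Topology Bundle
open Literature.Topology.FourManifolds Literature.Topology.FourManifolds.HandleAttachingMap
  Literature.Topology.FourManifolds.LefschetzBase Literature.Geometry.Symplectic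

/-! ## §1 Concatenation and re-indexing of isotopies of links; rescaling framings -/

section Links

variable {W : Type} [TopologicalSpace W] [ChartedSpace (EuclideanHalfSpace 4) W]

/-- **Concatenation of isotopies of links in `∂W`** (componentwise `KnotIsotopyInBoundary.trans'`;
at every time all components are at the same reparametrised time of the same half, so they stay
disjoint). [folklore] -/
theorem exists_linkIsotopy_trans {ι : Type*} {L L' L'' : ι → sphere (0 : EuclideanSpace ℝ (Fin 2)) 1 → W}
    (Φ : LinkIsotopyInBoundary L L') (Ψ : LinkIsotopyInBoundary L' L'') :
    ∃ Θ : LinkIsotopyInBoundary L L'', ∀ i, Θ.isotopy i = (Φ.isotopy i).trans' (Ψ.isotopy i) := by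
  refine ⟨⟨fun i => (Φ.isotopy i).trans' (Ψ.isotopy i), fun t _ i j hij => ?_⟩, fun i => rfl⟩
  show Disjoint (range (((Φ.isotopy i).trans' (Ψ.isotopy i)).toFun t))
    (range (((Φ.isotopy j).trans' (Ψ.isotopy j)).toFun t))
  rw [KnotIsotopyInBoundary.trans'_toFun, KnotIsotopyInBoundary.trans'_toFun]
  by_cases ht : t ≤ 1 / 2
  · rw [if_pos ht, if_pos ht]
    exact Φ.disjoint _ (KnotIsotopyInBoundary.ρ₁_mem t) hij
  · rw [if_neg ht, if_neg ht]
    exact Ψ.disjoint _ (KnotIsotopyInBoundary.ρ₂_mem t) hij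

/-- **Re-indexing an isotopy of links along an injection** (a sub-link moves by a link isotopy).
[folklore] -/
theorem exists_linkIsotopy_reindex {ι ι' : Type*} {L L' : ι → sphere (0 : EuclideanSpace ℝ (Fin 2)) 1 → W}
    (Φ : LinkIsotopyInBoundary L L') (f : ι' → ι) (hf : Injective f) :
    ∃ Θ : LinkIsotopyInBoundary (fun i => L (f i)) (fun i => L' (f i)), ∀ i, Θ.isotopy i = Φ.isotopy (f i) :=
  ⟨⟨fun i => Φ.isotopy (f i), fun t ht _ _ hij => Φ.disjoint t ht (hf.ne hij)⟩, fun _ => rfl⟩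

variable [IsManifold (𝓡∂ 4) ∞ W]

/-- A non-zero multiple of a framing is a framing. [folklore] -/
theorem isKnotFraming_smul {K : sphere (0 : EuclideanSpace ℝ (Fin 2)) 1 → W}
    {ν : sphere (0 : EuclideanSpace ℝ (Fin 2)) 1 → EuclideanSpace ℝ (Fin 4)} (hν : IsKnotFraming K ν)
    {a : ℝ} (ha : a ≠ 0) : IsKnotFraming K fun u => a • ν u where
  continuous := by
    have h := continuous_totalSpace_lincomb (I := 𝓡∂ 4) hν.continuous hν.continuous
      (continuous_const (y := a)) (continuous_const (y := (0 : ℝ)))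
    exact h.congr fun u => by rw [zero_smul, add_zero]
  mem_boundaryTangentSpace u := Submodule.smul_mem _ a (hν.mem_boundaryTangentSpace u)
  not_mem_span t h := hν.not_mem_span t (by
    have h1 := Submodule.smul_mem _ a⁻¹ h
    rwa [smul_smul, inv_mul_cancel₀ ha, one_smul] at h1)

/-- **A positive multiple of a framing is homotopic to it** (through the positive multiples
`((1 - s) a + s) • ν`). [folklore] -/
theorem framingHomotopic_smul_pos {K : sphere (0 : EuclideanSpace ℝ (Fin 2)) 1 → W}
    {ν : sphere (0 : EuclideanSpace ℝ (Fin 2)) 1 → EuclideanSpace ℝ (Fin 4)} (hK : IsBoundaryKnot K)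
    (hν : IsKnotFraming K ν) {a : ℝ} (ha : 0 < a) : FramingHomotopic K (fun u => a • ν u) ν := by
  refine ⟨hK, fun s u => ((1 - s) * a + s) • ν u, ⟨?_, ?_, ?_⟩, ?_⟩
  · funext u
    simp
  · intro s hs
    have hpos : 0 < (1 - s) * a + s := by
      rcases eq_or_lt_of_le hs.2 with h1 | h1
      · rw [h1]; norm_num
      · nlinarith [hs.1]
    exact isKnotFraming_smul hν hpos.ne'
  · have h := continuous_totalSpace_lincomb (I := 𝓡∂ 4) (c := fun p : ℝ × sphere (0 : EuclideanSpace ℝ (Fin 2)) 1 => K p.2)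
      (a := fun p : ℝ × sphere (0 : EuclideanSpace ℝ (Fin 2)) 1 => (1 - p.1) * a)
      (b := fun p : ℝ × sphere (0 : EuclideanSpace ℝ (Fin 2)) 1 => p.1)
      (hν.continuous.comp continuous_snd) (hν.continuous.comp continuous_snd) (by fun_prop) (by fun_prop)
    refine (h.congr fun p => ?_).continuousOn
    show (TotalSpace.mk' (EuclideanSpace ℝ (Fin 4)) (K p.2) (((1 - p.1) * a) • ν p.2 + p.1 • ν p.2) :
      TangentBundle (𝓡∂ 4) W) = TotalSpace.mk' (EuclideanSpace ℝ (Fin 4)) (K p.2) (((1 - p.1) * a + p.1) • ν p.2)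
    rw [add_smul]
  · funext u
    simp

end Links

/-! ## §2 The page twisting of a framed page curve is an invariant of the homotopy class of the framing -/

section Twisting

variable {g : ℕ}

/-- **Homotopic framings of a smoothly embedded page curve have the same page twisting**: along the
homotopy the twisting loops vary continuously (`pageTwisting_eq_of_bundle_family`; the curve is fixed
and `C¹`) and never vanish (`pageTwistingLoop_ne_zero_of_isKnotFraming`: every stage is a knot
framing of a page curve). [cite: EtnyreFuller2006, §2] -/
theorem pageTwisting_eq_of_framingHomotopic {K : sphere (0 : EuclideanSpace ℝ (Fin 2)) 1 → Base g}
    {ν ν' : sphere (0 : EuclideanSpace ℝ (Fin 2)) 1 → EuclideanSpace ℝ (Fin 4)} {c : ℂ} (hc : ‖c‖ = 1)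
    (hpage : ∀ θ, K θ ∈ page g c) (h : FramingHomotopic K ν ν') :
    pageTwisting g K ν = pageTwisting g K ν' := by
  obtain ⟨hK, νt, hνt, rfl⟩ := h
  have h0 : νt 0 = ν := hνt.apply_zero
  rw [← h0]
  have hKs : ContMDiff (𝓡 1) (𝓡∂ 4) 1 K := hK.isSmoothEmbedding.contMDiff.of_le (by simp)
  have hamb : ContDiff ℝ 1 (ambCurve g K) := by
    have h : ContMDiff 𝓘(ℝ, ℝ) (𝓡 4) 1 (ambCurve g K) :=
      ((RegularSublevel.contMDiff_incl (isRegularLevel_rho g)).of_le (by simp)).comp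
        (hKs.comp (contMDiff_circlePt.of_le (by simp)))
    exact contMDiff_iff_contDiff.1 h
  refine pageTwisting_eq_of_bundle_family (K := fun _ => K) (ν := νt) hνt.continuousOn
    (continuousOn_deriv_of_contDiff_family (K := fun _ => K) (hamb.comp contDiff_snd) _) ?_
  intro s hs t _
  exact pageTwistingLoop_ne_zero_of_isKnotFraming hc hK.isSmoothEmbedding hpage (hνt.isKnotFraming s hs) t

end Twisting

/-! ## §3 ISO + TUBE for framed page links -/

section PageLink

/-- **Sub-goal `helper_dualLink_pageLink_of` of stub `stub_steinRealisation`** (NF6 ▸ T3 ▸ T3c-3, the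
`Base g` side; wave 3, lead c5).  Let `q i` (`i : ι`, finite) be attaching maps of 2-handles on
`Base g`, `Φ` an isotopy of links in `∂ Base g` from their attaching circles to curves `K' i` lying in
pages `page g (c i)` (`‖c i‖ = 1`), `νt i` framing families along `Φ` from the handle framings of the
`q i`, ending at framings homotopic to framings `ν' i` of the `K' i`; suppose every `K' i` has
non-zero shadow and page twisting `pageTwisting g (K' i) (ν' i) = ε` for one `ε = ±1`.  Then there are
`s : Bool` and attaching maps `h' i` with attaching circles the `K' i` — in pages, of non-zero shadow,
of uniform page twisting `if s then -1 else 1` (`= ε`), with pairwise disjoint ranges — such that every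
`W₂` which is `Base g` with 2-handles attached along `q` is `Base g` with 2-handles attached along `h'`.
Proof: TUBE inside pairwise disjoint neighbourhoods of the `K' i` (the base is orientable), the page
twisting being an invariant of the homotopy class of the framing (§2), then ISO.
[cite: Kosinski1993, VI §6 and VIII proof of (1.2)] -/
theorem helper_dualLink_pageLink_of : ∀ (g : ℕ) (ι : Type) [Finite ι] (q : ι → Literature.Topology.FourManifolds.HandleAttachingMap 3 2 (Literature.Topology.FourManifolds.LefschetzBase.Base g)) (c : ι → ℂ) (K' : ι → Metric.sphere (0 : EuclideanSpace ℝ (Fin 2)) 1 → Literature.Topology.FourManifolds.LefschetzBase.Base g) (ν' : ι → Metric.sphere (0 : EuclideanSpace ℝ (Fin 2)) 1 → EuclideanSpace ℝ (Fin 4)) (Φ : Literature.Geometry.Symplectic.LinkIsotopyInBoundary (fun i => (q i).attachingCircle) K') (νt : ι → ℝ → Metric.sphere (0 : EuclideanSpace ℝ (Fin 2)) 1 → EuclideanSpace ℝ (Fin 4)) (hK'c : ∀ i, Continuous (K' i)) (ε : ℤ), (∀ i, ‖c i‖ = 1) → (∀ i θ, K' i θ ∈ Literature.Topology.FourManifolds.LefschetzBase.page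 g (c i)) → (∀ i, Literature.Geometry.Symplectic.IsFramingAlong (Φ.isotopy i) (q i).attachingFraming (νt i)) → (∀ i, Literature.Geometry.Symplectic.FramingHomotopic (K' i) (νt i 1) (ν' i)) → (∀ i, Literature.Topology.FourManifolds.LefschetzBase.shadow g (K' i) (hK'c i) ≠ 0) → (ε = 1 ∨ ε = -1) → (∀ i, Literature.Topology.FourManifolds.LefschetzBase.pageTwisting g (K' i) (ν' i) = ε) → ∃ (s : Bool) (h' : ι → Literature.Topology.FourManifolds.HandleAttachingMap 3 2 (Literature.Topology.FourManifolds.LefschetzBase.Base g)), (∀ i, (h' i).attachingCircle = K' i) ∧ (∀ i, ∃ c : ℂ, ‖c‖ = 1 ∧ ∀ θ, (h' i).attachingCircle θ ∈ Literature.Topology.FourManifolds.LefschetzBase.page g c) ∧ (∀ i, Literature.Topology.FourManifolds.LefschetzBase.shadow g (h' i).attachingCircle (h' i).continuous_attachingCircle ≠ 0) ∧ (∀ i, Literature.Topology.FourManifolds.LefschetzBase.pageTwisting g (h' i).attachingCircle (h' i).attachingFraming = if s then -1 else 1) ∧ (Pairwise fun i j => Disjoint (Set.range (h' i).toFun) (Set.range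 (h' j).toFun)) ∧ ∀ (W₂ : Type) [TopologicalSpace W₂] [ChartedSpace (EuclideanHalfSpace 4) W₂] [IsManifold (𝓡∂ 4) ∞ W₂], Literature.Topology.FourManifolds.HandleAttachingMap.IsMultiAttachment q (𝓡∂ 4) W₂ → Literature.Topology.FourManifolds.HandleAttachingMap.IsMultiAttachment h' (𝓡∂ 4) W₂ := by
  intro g ι _ q c K' ν' Φ νt hK'c ε hc hpage hfr hend hsh hε htw
  -- pairwise disjoint open neighbourhoods of the pairwise disjoint compact end curves
  have hlink : IsBoundaryLink K' := Φ.isBoundaryLink_right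
  have hcpt : ∀ i, IsCompact (range (K' i)) := fun i => isCompact_range (hK'c i)
  obtain ⟨U, hUo, hKU, hUd⟩ := exists_pairwise_disjoint_open_of_isCompact _ hcpt hlink.disjoint
  -- TUBE: attaching maps along the framed page curves `(K' i, ν' i)` inside `U i`
  have htube : ∀ i, ∃ h' : HandleAttachingMap 3 2 (Base g), range h'.toFun ⊆ U i ∧
      h'.attachingCircle = K' i ∧ FramingHomotopic (K' i) (ν' i) h'.attachingFraming := fun i =>
    exists_handleAttachingMap_of_isKnotFraming_holds (Base g) (isOrientable_base g) (K' i) (ν' i)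
      (hlink.isBoundaryKnot i) (hend i).isKnotFraming_right (U i) (hUo i) (hKU i)
  choose h' hrange hcirc hhom using htube
  have hdis' : Pairwise fun i j => Disjoint (range (h' i).toFun) (range (h' j).toFun) :=
    fun i j hij => Set.disjoint_of_subset (hrange i) (hrange j) (hUd hij)
  -- the page twisting of the new handle framings is `ε`
  have htw' : ∀ i, pageTwisting g (h' i).attachingCircle (h' i).attachingFraming = ε := by
    intro i
    rw [← htw i]
    have e := hcirc i
    have h1 : pageTwisting g (K' i) (h' i).attachingFraming = pageTwisting g (K' i) (ν' i) :=
      (pageTwisting_eq_of_framingHomotopic (hc i) (hpage i) (hhom i)).symm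
    rw [← h1]
    exact congrArg (fun L => pageTwisting g L (h' i).attachingFraming) e
  -- identify the end curves with the attaching circles of the new maps, then ISO
  have hK'eq : (fun i => (h' i).attachingCircle) = K' := funext hcirc
  subst hK'eq
  refine ⟨decide (ε = -1), h', fun i => rfl, fun i => ⟨c i, hc i, hpage i⟩, fun i => hsh i, fun i => ?_,
    hdis', fun W₂ _ _ _ hW₂ => ?_⟩
  · rw [htw' i]
    rcases hε with h1 | h1 <;> subst h1 <;> decide
  · exact HandleAttachingMap.isMultiAttachment_of_linkIsotopyInBoundary_holds (Base g) W₂ ι q h' Φ νt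
      hfr (fun i => (hend i).trans (hhom i)) hdis' hW₂

end PageLink

end Summit.SmoothPoincare4.SmoothPoincare4.Theorems.AcyclicBisectionExists.ModpBraidOrbits

end
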